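import Summits.QuantumFields.BalabanUV.Beta.GAN24.SrecChargeBlockPotentials

/-!
# `BalabanUV.Beta.GAN24.SrecChargeLamDropsAllLevels` — binder row G-an2-4 ∕ (CONV-C), the (S) row of RULING R-gan24p1-g27-1 B (viii), road-P2's (W-γ) CHARGE TOWER
# (p2 g41 `ChargeTowerClimb` §7 ∕ `ChargeTowerClimbZero` §4: «LEFT for the assembly: the hypothesis is on the FULL member `SrecAt (j+1)` = S-pure + Λ + VH shares (VH ff
# share = 0; Λ share on class 𝒟 = leaf-02 g57 §3 one level up)»), PART D of leaf-02 g57: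
# **AT EVERY LEVEL `j` THE FULL MEMBER's CLASS-𝒟 PAIR CHARGE IS THE PURE MEMBER's — the Λ-letter of `SrecAt … j` (level `0`: `cΛ•SLam Lc (lamCoeffOf KInv Lc) h^ρ`; level `j+1`:
# `(cΛ·wΛ_{j+1})•SLam Lc (lamCoeffK …) h^ρ`) contributes NOTHING to `Σ'_{(x,z)} g₁(x)·g₂(z)·S κ u x z (inl a)(inl b)` for road-P2's exit-supported block-constant weights
# `g_i = 𝟙^{exit}·f_i∘blk`, bounded `f_i` — so the tower's hypothesis `hC` on the full member and its conclusion on the pure member are the SAME statement**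
# (G-an2-4 formalisation swarm → CRUX TEAM (2), seat `b2b-balaban-gan24-formalise-leaf-02`, gen 57)

NOT IN PRINT; OUR BOOKKEEPING ([folklore] packaging BY NAME: PART B `SrecChargeBlockPotentials` §3 (`sum_dz_mul_tsum_sum_dz_mul_SLam_hessFFAt_eq_zero`, ANY placement, ANY
coefficient family) + §5 (`summable_prod_wt_mul_of_biLoc`, `blockPot_forwardDiff_eq_exitWt`), PART A `exists_forwardDiff_eq` ∕ `sum_dz_coordPot_mul`, an2's
`SrecAt_eq_SpureRecAt_add_lam_zero ∕ _succ` (`rfl`), leaf-10∕an2's `locStencil_SrecAt`, `locStencil_SpureRecAt`, g56's `tsum_prod_eq_tsum_tsum_swap`; 0 `def`, 0 cited fact,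
0 `def … : Prop`, 0 sorry).  HONEST FRAMING (cell contract, verbatim): «discharging `BetaPertH` makes Bałaban's UV stability UNCONDITIONAL — a real constructive-QFT result;
it is NOT the continuum limit and NOT the Clay problem.»  HONEST DEPENDENCY (verbatim): «continuum YM on T⁴ ⇐ BetaPertH ∧ nine spine estimates (0/9 proved); BetaPertH ⇐ (D1) ∧ (D4)
∧ CAP+tail; G-an2-4 gates asym, D1 and NE2/3/4.»

WHAT (generic `d`; box root `ρ = toSite r`, `r ∈ box (d+1) Lc`, `Lc ≥ 1`; weights `w_i(x) := if x_{a_i} % Lc = Lc − 1 then f_i (blk Lc x a_i) else 0`, `|f_i| ≤ B_i`).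
* §1 `abs_exitWt_le` (`|w_i| ≤ B_i`), `summable_prod_exitWt_srecAt` ∕ `summable_prod_exitWt_spureRecAt` (every level, from the local-stencil property),
  `srecAt_sub_spureRecAt` (every level `j`: `SrecAt j κ u − SpureRecAt j κ u = s_j • SLam Lc c_j h^ρ κ u` for SOME scalar `s_j` and coefficient family `c_j` — the two `rfl`
  splittings read uniformly in `j`).
* §2 **`tsum_prod_exitWt_SLam_hessFFAt_eq_zero`** (ANY `N`, ANY `c`, given product summability: the Λ-letter's class-𝒟 pair charge is `0` — PART B §3 in pair currency, the weights
  written as `dz` of the primitives `F_i∘⌊·∕Lc⌋`, `ΔF_i = f_i`).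
* §3 **`tsum_prod_exitWt_srecAt_eq_spureRecAt`** (EVERY `j`: `Σ'_{(x,z)} w₁ w₂·SrecAt … j κ u x z (inl a)(inl b) = Σ'_{(x,z)} w₁ w₂·SpureRecAt … j κ u x z (inl a)(inl b)`) and the `HasSum`
  transfer **`hasSum_prod_exitWt_srecAt_of_spureRecAt`** ∕ **`…_spureRecAt_of_srecAt`** (a value for one member is a value for the other).
Asserts NO value of any table beyond these equalities; NOTHING of (W-γ)'s exit sub-row ∕ (INV) ∕ (S) ∕ (Q-R) ∕ (DL) ∕ «T2Shape» ∕ (hW, hWall) discharged; the re-gauging of the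
tower's potential (bounded, off the comb) is NOT touched; NEVER «G-an2-4 closed» as (CONV-C); NOT D1, NOT `BetaPertH`, NOT continuum, NOT Clay.  2026-08-22; no existing file touched.
-/

noncomputable section

open Finset
open scoped BigOperators
open Literature.MathematicalPhysics.QuantumFieldTheory
open Literature.MathematicalPhysics.QuantumFieldTheory.Balaban1983to89
open Literature.MathematicalPhysics.QuantumFieldTheory.Balaban1983to89.Beta
open ExpKernelCalculus (Site MKer BiLoc)
open OneStepResolventKernel (Fib KInv LocStencil)
open AffineAveraging (Form1 box toSite unitVec dz)
open AveragingContours (blk)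
open AveragingHessianKernelsRooted (hessFFAt)
open InterLevelTransport (SLam)
open BalabanStepJets (lamCoeffOf)
open BalabanStepJetsSucc (E2 lamCoeffK wΛ)
open OneStepKernelFamily (KInvStep)
open Summit.QuantumFields.BalabanUV.Beta.SpineRooted (SpureRecAt locStencil_SpureRecAt SrecAt_eq_SpureRecAt_add_lam_zero SrecAt_eq_SpureRecAt_add_lam_succ)
open Summit.QuantumFields.BalabanUV.Beta.WardLocusRecursive (SrecAt locStencil_SrecAt)
open Summit.QuantumFields.BalabanUV.Beta.GAN24.SymLinKernelFaceSupport (int_ediv_add_one)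
open Summit.QuantumFields.BalabanUV.Beta.GAN24.SpureSlotChargeLevelZero (tsum_prod_eq_tsum_tsum_swap)
open Summit.QuantumFields.BalabanUV.Beta.GAN24.WilsonPairFormCharge (sum_dz_coordPot_mul exists_forwardDiff_eq)
open Summit.QuantumFields.BalabanUV.Beta.GAN24.SrecChargeBlockPotentials (sum_dz_mul_tsum_sum_dz_mul_SLam_hessFFAt_eq_zero summable_prod_wt_mul_of_biLoc
  blockPot_forwardDiff_eq_exitWt)

namespace Summit.QuantumFields.BalabanUV.Beta.GAN24.SrecChargeLamDropsAllLevels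

variable {d : ℕ}

/-! ## §1 The weights, the summabilities, the uniform Λ-split -/

/-- [folklore] Road-P2's exit-supported block weight is bounded by the bound of its coarse factor. -/
theorem abs_exitWt_le {Lc : ℕ} {f : ℤ → ℝ} {B : ℝ} (hf : ∀ s, |f s| ≤ B) (a : Fin (d + 1)) (x : Site (d + 1)) :
    |(if x a % (Lc : ℤ) = (Lc : ℤ) - 1 then f (blk Lc x a) else 0)| ≤ B := by
  split_ifs
  · exact hf _
  · rw [abs_zero]; exact (abs_nonneg _).trans (hf 0)

/-- [folklore] Every member of the FULL table against two such weights is summable on `Site × Site` (in-block root, `Lc ≥ 1`). -/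
theorem summable_prod_exitWt_srecAt {Lc : ℕ} [NeZero Lc] (hLc : 1 ≤ Lc) {r : Fin (d + 1) → ℕ} (hr : r ∈ box (d + 1) Lc) (cE cVH cΛ : ℝ) (j : ℕ)
    {f₁ f₂ : ℤ → ℝ} {B₁ B₂ : ℝ} (hf₁ : ∀ s, |f₁ s| ≤ B₁) (hf₂ : ∀ s, |f₂ s| ≤ B₂) (κ : Fin (d + 1)) (u : Site (d + 1)) (a b : Fin (d + 1)) (p q : Fib d) :
    Summable fun xz : Site (d + 1) × Site (d + 1) =>
      (if xz.1 a % (Lc : ℤ) = (Lc : ℤ) - 1 then f₁ (blk Lc xz.1 a) else 0) * (if xz.2 b % (Lc : ℤ) = (Lc : ℤ) - 1 then f₂ (blk Lc xz.2 b) else 0)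
        * SrecAt d Lc (toSite r) cE cVH cΛ j κ u xz.1 xz.2 p q := by
  obtain ⟨Cs, δ, hδ, hS⟩ := locStencil_SrecAt (d := d) (Lc := Lc) hLc hr cE cVH cΛ j
  exact summable_prod_wt_mul_of_biLoc (hS κ u) hδ (fun x => abs_exitWt_le hf₁ a x) (fun z => abs_exitWt_le hf₂ b z) p q

/-- [folklore] The same for the PURE table. -/
theorem summable_prod_exitWt_spureRecAt {Lc : ℕ} [NeZero Lc] (hLc : 1 ≤ Lc) {r : Fin (d + 1) → ℕ} (hr : r ∈ box (d + 1) Lc) (cE cVH cΛ : ℝ) (j : ℕ)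
    {f₁ f₂ : ℤ → ℝ} {B₁ B₂ : ℝ} (hf₁ : ∀ s, |f₁ s| ≤ B₁) (hf₂ : ∀ s, |f₂ s| ≤ B₂) (κ : Fin (d + 1)) (u : Site (d + 1)) (a b : Fin (d + 1)) (p q : Fib d) :
    Summable fun xz : Site (d + 1) × Site (d + 1) =>
      (if xz.1 a % (Lc : ℤ) = (Lc : ℤ) - 1 then f₁ (blk Lc xz.1 a) else 0) * (if xz.2 b % (Lc : ℤ) = (Lc : ℤ) - 1 then f₂ (blk Lc xz.2 b) else 0)
        * SpureRecAt d Lc (toSite r) cE cVH cΛ j κ u xz.1 xz.2 p q := by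
  obtain ⟨Cs, δ, hδ, hS⟩ := locStencil_SpureRecAt (d := d) (Lc := Lc) hLc hr cE cVH cΛ j
  exact summable_prod_wt_mul_of_biLoc (hS κ u) hδ (fun x => abs_exitWt_le hf₁ a x) (fun z => abs_exitWt_le hf₂ b z) p q

/-- [folklore] **THE Λ-SPLIT READ UNIFORMLY IN THE LEVEL**: for every `j` there are a scalar `s` and a coefficient family `c` with
`SrecAt … j κ u = SpureRecAt … j κ u + s • SLam Lc c h^ρ κ u` (an2's two `rfl` splittings: `s = cΛ`, `c = lamCoeffOf KInv Lc` at `j = 0`; `s = cΛ·wΛ_{j}`,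
`c = lamCoeffK (KInvStep Lc j) (E2 j) Lc` at `j ≥ 1`). -/
theorem srecAt_eq_spureRecAt_add {Lc : ℕ} [NeZero Lc] (ρ : Fin (d + 1) → ℤ) (cE cVH cΛ : ℝ) (j : ℕ) :
    ∃ (s : ℝ) (c : Fin (d + 1) → (Fin (d + 1) → ℤ) → Fin (d + 1) → (Fin (d + 1) → ℤ) → ℝ),
      ∀ κ u, SrecAt d Lc ρ cE cVH cΛ j κ u = SpureRecAt d Lc ρ cE cVH cΛ j κ u + s • SLam Lc c (fun μ y => hessFFAt ρ Lc μ y) κ u := by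
  cases j with
  | zero => exact ⟨cΛ, lamCoeffOf (KInv (N := Lc) (d := d)) Lc, fun κ u => SrecAt_eq_SpureRecAt_add_lam_zero ρ cE cVH cΛ κ u⟩
  | succ j => exact ⟨cΛ * wΛ d Lc (j + 1), lamCoeffK (KInvStep (d := d) Lc (j + 1)) (E2 d Lc (j + 1)) Lc,
      fun κ u => SrecAt_eq_SpureRecAt_add_lam_succ ρ cE cVH cΛ j κ u⟩

/-! ## §2 The Λ-letter's class-𝒟 pair charge vanishes (pair currency) -/

/-- NOT IN PRINT; OUR BOOKKEEPING.  **THE Λ-LETTER's PAIR CHARGE AGAINST ROAD-P2's WEIGHTS IS ZERO** (box root, `Lc ≥ 1`; ANY placement `N`, ANY coefficient family `c`; bounded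
`f_i`; given the product summability of the integrand): `Σ'_{(x,z)} w₁(x)·w₂(z)·SΛ κ u x z (inl a)(inl b) = 0` — each weight is `dz` of a block-constant primitive
(`exists_forwardDiff_eq` + `blockPot_forwardDiff_eq_exitWt`), and PART B §3's four-site lemma kills the iterated sum pointwise in the outer leg. -/
theorem tsum_prod_exitWt_SLam_hessFFAt_eq_zero {Lc : ℕ} (hLc : 1 ≤ Lc) {r : Fin (d + 1) → ℕ} (hr : r ∈ box (d + 1) Lc) {N : ℕ} [NeZero N]
    (c : Fin (d + 1) → (Fin (d + 1) → ℤ) → Fin (d + 1) → (Fin (d + 1) → ℤ) → ℝ) (f₁ f₂ : ℤ → ℝ) (κ : Fin (d + 1)) (u : Site (d + 1)) (a b : Fin (d + 1))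
    (hsum : Summable fun xz : Site (d + 1) × Site (d + 1) =>
      (if xz.1 a % (Lc : ℤ) = (Lc : ℤ) - 1 then f₁ (blk Lc xz.1 a) else 0) * (if xz.2 b % (Lc : ℤ) = (Lc : ℤ) - 1 then f₂ (blk Lc xz.2 b) else 0)
        * SLam N c (fun μ y => hessFFAt (toSite r) Lc μ y) κ u xz.1 xz.2 (Sum.inl a) (Sum.inl b)) :
    ∑' xz : Site (d + 1) × Site (d + 1),
      (if xz.1 a % (Lc : ℤ) = (Lc : ℤ) - 1 then f₁ (blk Lc xz.1 a) else 0) * (if xz.2 b % (Lc : ℤ) = (Lc : ℤ) - 1 then f₂ (blk Lc xz.2 b) else 0)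
        * SLam N c (fun μ y => hessFFAt (toSite r) Lc μ y) κ u xz.1 xz.2 (Sum.inl a) (Sum.inl b) = 0 := by
  obtain ⟨F₁, hF₁⟩ := exists_forwardDiff_eq f₁
  obtain ⟨F₂, hF₂⟩ := exists_forwardDiff_eq f₂
  -- the weights as differentials of the block-constant primitives
  have hw₁ : ∀ x : Site (d + 1), (if x a % (Lc : ℤ) = (Lc : ℤ) - 1 then f₁ (blk Lc x a) else 0) = F₁ ((x a + 1) / (Lc : ℤ)) - F₁ (x a / (Lc : ℤ)) :=
    fun x => (blockPot_forwardDiff_eq_exitWt hLc hF₁ (x a)).symm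
  have hw₂ : ∀ z : Site (d + 1), (if z b % (Lc : ℤ) = (Lc : ℤ) - 1 then f₂ (blk Lc z b) else 0) = F₂ ((z b + 1) / (Lc : ℤ)) - F₂ (z b / (Lc : ℤ)) :=
    fun z => (blockPot_forwardDiff_eq_exitWt hLc hF₂ (z b)).symm
  rw [tsum_prod_eq_tsum_tsum_swap (F := fun x z => (if x a % (Lc : ℤ) = (Lc : ℤ) - 1 then f₁ (blk Lc x a) else 0)
    * (if z b % (Lc : ℤ) = (Lc : ℤ) - 1 then f₂ (blk Lc z b) else 0) * SLam N c (fun μ y => hessFFAt (toSite r) Lc μ y) κ u x z (Sum.inl a) (Sum.inl b)) hsum]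
  refine (tsum_congr fun z => ?_).trans tsum_zero
  -- the pointwise vanishing in the outer leg `z`: PART B §3 with `ψa = F₁∘⌊·_a∕Lc⌋`, `ψb = F₂∘⌊·_b∕Lc⌋`
  have h0 := sum_dz_mul_tsum_sum_dz_mul_SLam_hessFFAt_eq_zero (N := N) hLc hr c (ψa := fun w : Site (d + 1) => F₁ (w a / (Lc : ℤ)))
    (ψb := fun w : Site (d + 1) => F₂ (w b / (Lc : ℤ))) (fun y => F₁ (y a)) (fun y => F₂ (y b)) (fun w => rfl) (fun w => rfl) κ u z
  have e1 : ∀ (x : Site (d + 1)) (T : Fin (d + 1) → ℝ), ∑ α, dz (fun w : Site (d + 1) => F₁ (w a / (Lc : ℤ))) α x * T α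
      = (F₁ ((x a + 1) / (Lc : ℤ)) - F₁ (x a / (Lc : ℤ))) * T a := fun x T => sum_dz_coordPot_mul (fun t => F₁ (t / (Lc : ℤ))) a x T
  have e2 : ∀ (T : Fin (d + 1) → ℝ), ∑ β, dz (fun w : Site (d + 1) => F₂ (w b / (Lc : ℤ))) β z * T β
      = (F₂ ((z b + 1) / (Lc : ℤ)) - F₂ (z b / (Lc : ℤ))) * T b := fun T => sum_dz_coordPot_mul (fun t => F₂ (t / (Lc : ℤ))) b z T
  simp only [e1, e2] at h0
  -- `h0 : ΔG₂(z_b) * Σ'_x ΔG₁(x_a) * SΛ x z (inl a)(inl b) = 0`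
  have e3 : ∀ x : Site (d + 1), (if x a % (Lc : ℤ) = (Lc : ℤ) - 1 then f₁ (blk Lc x a) else 0)
        * (if z b % (Lc : ℤ) = (Lc : ℤ) - 1 then f₂ (blk Lc z b) else 0) * SLam N c (fun μ y => hessFFAt (toSite r) Lc μ y) κ u x z (Sum.inl a) (Sum.inl b)
      = (F₂ ((z b + 1) / (Lc : ℤ)) - F₂ (z b / (Lc : ℤ)))
        * ((F₁ ((x a + 1) / (Lc : ℤ)) - F₁ (x a / (Lc : ℤ))) * SLam N c (fun μ y => hessFFAt (toSite r) Lc μ y) κ u x z (Sum.inl a) (Sum.inl b)) := fun x => by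
    rw [hw₁, hw₂]; ring
  rw [tsum_congr e3, tsum_mul_left]
  exact h0

/-! ## §3 Full member = pure member on class 𝒟, every level -/

/-- NOT IN PRINT; OUR BOOKKEEPING.  **AT EVERY LEVEL THE FULL MEMBER's CLASS-𝒟 PAIR CHARGE IS THE PURE MEMBER's** (box root, `Lc ≥ 1`, bounded `f_i`, every `j`, every slot,
every ff channel): `Σ'_{(x,z)} w₁(x)·w₂(z)·SrecAt d Lc ρ cE cVH cΛ j κ u x z (inl a)(inl b) = Σ'_{(x,z)} w₁(x)·w₂(z)·SpureRecAt d Lc ρ cE cVH cΛ j κ u x z (inl a)(inl b)` — road-P2's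
tower hypothesis `hC` on the FULL member (`ChargeTowerClimb` §7, `ChargeTowerClimbZero` §4) and its conclusion on the PURE member are one and the same statement. -/
theorem tsum_prod_exitWt_srecAt_eq_spureRecAt {Lc : ℕ} [NeZero Lc] (hLc : 1 ≤ Lc) {r : Fin (d + 1) → ℕ} (hr : r ∈ box (d + 1) Lc) (cE cVH cΛ : ℝ) (j : ℕ)
    {f₁ f₂ : ℤ → ℝ} {B₁ B₂ : ℝ} (hf₁ : ∀ s, |f₁ s| ≤ B₁) (hf₂ : ∀ s, |f₂ s| ≤ B₂) (κ : Fin (d + 1)) (u : Site (d + 1)) (a b : Fin (d + 1)) :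
    ∑' xz : Site (d + 1) × Site (d + 1),
        (if xz.1 a % (Lc : ℤ) = (Lc : ℤ) - 1 then f₁ (blk Lc xz.1 a) else 0) * (if xz.2 b % (Lc : ℤ) = (Lc : ℤ) - 1 then f₂ (blk Lc xz.2 b) else 0)
          * SrecAt d Lc (toSite r) cE cVH cΛ j κ u xz.1 xz.2 (Sum.inl a) (Sum.inl b)
      = ∑' xz : Site (d + 1) × Site (d + 1),
        (if xz.1 a % (Lc : ℤ) = (Lc : ℤ) - 1 then f₁ (blk Lc xz.1 a) else 0) * (if xz.2 b % (Lc : ℤ) = (Lc : ℤ) - 1 then f₂ (blk Lc xz.2 b) else 0)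
          * SpureRecAt d Lc (toSite r) cE cVH cΛ j κ u xz.1 xz.2 (Sum.inl a) (Sum.inl b) := by
  obtain ⟨s, c, hsplit⟩ := srecAt_eq_spureRecAt_add (d := d) (Lc := Lc) (toSite r) cE cVH cΛ j
  have hS := summable_prod_exitWt_srecAt hLc hr cE cVH cΛ j hf₁ hf₂ κ u a b (Sum.inl a) (Sum.inl b)
  have hP := summable_prod_exitWt_spureRecAt hLc hr cE cVH cΛ j hf₁ hf₂ κ u a b (Sum.inl a) (Sum.inl b)
  -- the Λ-share's integrand = (full − pure)∕… is summable as a difference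
  have e : ∀ xz : Site (d + 1) × Site (d + 1),
      (if xz.1 a % (Lc : ℤ) = (Lc : ℤ) - 1 then f₁ (blk Lc xz.1 a) else 0) * (if xz.2 b % (Lc : ℤ) = (Lc : ℤ) - 1 then f₂ (blk Lc xz.2 b) else 0)
          * SrecAt d Lc (toSite r) cE cVH cΛ j κ u xz.1 xz.2 (Sum.inl a) (Sum.inl b)
        = (if xz.1 a % (Lc : ℤ) = (Lc : ℤ) - 1 then f₁ (blk Lc xz.1 a) else 0) * (if xz.2 b % (Lc : ℤ) = (Lc : ℤ) - 1 then f₂ (blk Lc xz.2 b) else 0)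
            * SpureRecAt d Lc (toSite r) cE cVH cΛ j κ u xz.1 xz.2 (Sum.inl a) (Sum.inl b)
          + s * ((if xz.1 a % (Lc : ℤ) = (Lc : ℤ) - 1 then f₁ (blk Lc xz.1 a) else 0) * (if xz.2 b % (Lc : ℤ) = (Lc : ℤ) - 1 then f₂ (blk Lc xz.2 b) else 0)
            * SLam Lc c (fun μ y => hessFFAt (toSite r) Lc μ y) κ u xz.1 xz.2 (Sum.inl a) (Sum.inl b)) := fun xz => by
    rw [hsplit κ u]
    simp only [Pi.add_apply, Pi.smul_apply, smul_eq_mul]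
    ring
  have hΛ : Summable fun xz : Site (d + 1) × Site (d + 1) =>
      s * ((if xz.1 a % (Lc : ℤ) = (Lc : ℤ) - 1 then f₁ (blk Lc xz.1 a) else 0) * (if xz.2 b % (Lc : ℤ) = (Lc : ℤ) - 1 then f₂ (blk Lc xz.2 b) else 0)
        * SLam Lc c (fun μ y => hessFFAt (toSite r) Lc μ y) κ u xz.1 xz.2 (Sum.inl a) (Sum.inl b)) := by
    have h := hS.sub hP
    refine h.congr fun xz => ?_
    rw [e xz]
    ring
  rw [tsum_congr e, hP.tsum_add hΛ, tsum_mul_left]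
  by_cases hs : s = 0
  · rw [hs, zero_mul, add_zero]
  · have hΛ' : Summable fun xz : Site (d + 1) × Site (d + 1) =>
        (if xz.1 a % (Lc : ℤ) = (Lc : ℤ) - 1 then f₁ (blk Lc xz.1 a) else 0) * (if xz.2 b % (Lc : ℤ) = (Lc : ℤ) - 1 then f₂ (blk Lc xz.2 b) else 0)
          * SLam Lc c (fun μ y => hessFFAt (toSite r) Lc μ y) κ u xz.1 xz.2 (Sum.inl a) (Sum.inl b) := by
      have h := hΛ.mul_left s⁻¹
      refine h.congr fun xz => ?_
      rw [← mul_assoc, inv_mul_cancel₀ hs, one_mul]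
    rw [tsum_prod_exitWt_SLam_hessFFAt_eq_zero hLc hr c f₁ f₂ κ u a b hΛ', mul_zero, add_zero]

/-- NOT IN PRINT; OUR BOOKKEEPING.  **`HasSum` TRANSFER, PURE ⇒ FULL**: a value of the pure member's class-𝒟 pair charge is the value of the full member's (every level). -/
theorem hasSum_prod_exitWt_srecAt_of_spureRecAt {Lc : ℕ} [NeZero Lc] (hLc : 1 ≤ Lc) {r : Fin (d + 1) → ℕ} (hr : r ∈ box (d + 1) Lc) (cE cVH cΛ : ℝ) (j : ℕ)
    {f₁ f₂ : ℤ → ℝ} {B₁ B₂ : ℝ} (hf₁ : ∀ s, |f₁ s| ≤ B₁) (hf₂ : ∀ s, |f₂ s| ≤ B₂) (κ : Fin (d + 1)) (u : Site (d + 1)) (a b : Fin (d + 1)) {v : ℝ}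
    (hv : HasSum (fun xz : Site (d + 1) × Site (d + 1) =>
      (if xz.1 a % (Lc : ℤ) = (Lc : ℤ) - 1 then f₁ (blk Lc xz.1 a) else 0) * (if xz.2 b % (Lc : ℤ) = (Lc : ℤ) - 1 then f₂ (blk Lc xz.2 b) else 0)
        * SpureRecAt d Lc (toSite r) cE cVH cΛ j κ u xz.1 xz.2 (Sum.inl a) (Sum.inl b)) v) :
    HasSum (fun xz : Site (d + 1) × Site (d + 1) =>
      (if xz.1 a % (Lc : ℤ) = (Lc : ℤ) - 1 then f₁ (blk Lc xz.1 a) else 0) * (if xz.2 b % (Lc : ℤ) = (Lc : ℤ) - 1 then f₂ (blk Lc xz.2 b) else 0)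
        * SrecAt d Lc (toSite r) cE cVH cΛ j κ u xz.1 xz.2 (Sum.inl a) (Sum.inl b)) v := by
  have hS := summable_prod_exitWt_srecAt hLc hr cE cVH cΛ j hf₁ hf₂ κ u a b (Sum.inl a) (Sum.inl b)
  rw [← hv.tsum_eq, ← tsum_prod_exitWt_srecAt_eq_spureRecAt hLc hr cE cVH cΛ j hf₁ hf₂ κ u a b]
  exact hS.hasSum

/-- NOT IN PRINT; OUR BOOKKEEPING.  **`HasSum` TRANSFER, FULL ⇒ PURE**. -/
theorem hasSum_prod_exitWt_spureRecAt_of_srecAt {Lc : ℕ} [NeZero Lc] (hLc : 1 ≤ Lc) {r : Fin (d + 1) → ℕ} (hr : r ∈ box (d + 1) Lc) (cE cVH cΛ : ℝ) (j : ℕ)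
    {f₁ f₂ : ℤ → ℝ} {B₁ B₂ : ℝ} (hf₁ : ∀ s, |f₁ s| ≤ B₁) (hf₂ : ∀ s, |f₂ s| ≤ B₂) (κ : Fin (d + 1)) (u : Site (d + 1)) (a b : Fin (d + 1)) {v : ℝ}
    (hv : HasSum (fun xz : Site (d + 1) × Site (d + 1) =>
      (if xz.1 a % (Lc : ℤ) = (Lc : ℤ) - 1 then f₁ (blk Lc xz.1 a) else 0) * (if xz.2 b % (Lc : ℤ) = (Lc : ℤ) - 1 then f₂ (blk Lc xz.2 b) else 0)
        * SrecAt d Lc (toSite r) cE cVH cΛ j κ u xz.1 xz.2 (Sum.inl a) (Sum.inl b)) v) :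
    HasSum (fun xz : Site (d + 1) × Site (d + 1) =>
      (if xz.1 a % (Lc : ℤ) = (Lc : ℤ) - 1 then f₁ (blk Lc xz.1 a) else 0) * (if xz.2 b % (Lc : ℤ) = (Lc : ℤ) - 1 then f₂ (blk Lc xz.2 b) else 0)
        * SpureRecAt d Lc (toSite r) cE cVH cΛ j κ u xz.1 xz.2 (Sum.inl a) (Sum.inl b)) v := by
  have hP := summable_prod_exitWt_spureRecAt hLc hr cE cVH cΛ j hf₁ hf₂ κ u a b (Sum.inl a) (Sum.inl b)
  rw [← hv.tsum_eq, tsum_prod_exitWt_srecAt_eq_spureRecAt hLc hr cE cVH cΛ j hf₁ hf₂ κ u a b]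
  exact hP.hasSum

end Summit.QuantumFields.BalabanUV.Beta.GAN24.SrecChargeLamDropsAllLevels

end
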